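import Summits.CriticalPhenomena.PercolationContinuityZ3.Theorems.PercNearOneGluingAdditiveGluingFingerSetForm
import Summits.CriticalPhenomena.PercolationContinuityZ3.Theorems.PercNearOneGluingAdditiveGluingTFingers
import HarnessLib

/-! # Crux `PercNearOneGluing.AdditiveGluing` (stmt-CriticalPhenomena-4576) — the finger multi-edge Lemma 3 (`stub_fingerML3_vp`)
# in STAR FORM, and its reduction to the domination inequality DI-K (seat (b) V⁺-form, depth prover `png-dp-vplus`, gen 5)

Support file (`--supports stmt-CriticalPhenomena-4576`); no definitions, no named facts.  Companion of
`…AdditiveGluingFingerSetForm.lean` (`fingerML3_of_setForm`: the stub is equivalent to its unglued set form) and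
`…AdditiveGluingTFingers.lean` (`finger_noContact_reach_null`).

Setting of the stub: a weighting `K` on `Fin n`, relays `A ∋ b, d`, a finger block `N` (`Disjoint N A`, every positive-weight pair at `N`
goes to `A` or stays inside `N`), `R` = "some pair `N–A` is open", `U = ⋃_{v∈N}{v↔b}` ("the block reaches `b`"), `M = {d ↮ N}`.
Write `SPLIT_d := U ∩ Mᶜ ∩ {d↮b}` = "the block reaches `b`, `d` is attached to the block, yet `d ↮ b`" — the configurations in which
gluing the block would newly connect `d` to `b` (the gluing GAIN of `d`).

* `fingerML3_setForm_iff_starForm` — **the star form**: the stub's unglued set form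
  `μ_K(R ∩ M ∩ {d↔b}) ≤ μ_K(R ∩ M ∩ U)` is equivalent to  `μ_K(R ∩ {d↔b}) + μ_K(SPLIT_d) ≤ μ_K(U)`,
  i.e. to Kozma–Nitzan's pre-FKG inequality (3) for the glued star vertex `[N]` of `K/N` at the designation `d`, written in `K`
  (proof: `U ⊆ R` and `Mᶜ ⊆ R` almost surely by `finger_noContact_reach_null`, and `{d↔b} ∩ Mᶜ ⊆ U`).
* `fingerML3_of_starForm` — hence the stub follows from the star form.
* `fingerML3_of_domination` — **reduction to DI-K**: if for some vertex `u`
  (DI-K)  `μ_K(R ∩ {u↔b}) + μ_K(SPLIT_d) ≤ μ_K(U)`   and   (Γ)  `μ_K(R ∩ {d↔b}) ≤ μ_K(R ∩ {u↔b})`,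
  then the stub's conclusion holds.  (Γ) is the stub's hypothesis at `u` restricted to `R` (it holds whenever `μ_K(d↔b) ≤ μ_K(u↔b)`
  and `u` is base-weaker than `d`, since off `R` both reliabilities are the base ones); (DI-K) with `u` = the contact minimising the
  UNGLUED two-point function `μ_K(·↔b)` is the depth prover's conjecture DI-K (memo MEMO-gen5.md: hypothesis-free, 0 violations in
  3.3·10⁷ exhaustive exact-structure instances, while the same inequality at the base-weakest contact fails), which therefore implies
  `stub_fingerML3_vp` for every number of relays.  For `u` = the base-weakest contact (DI-K) is Kozma–Nitzan's Lemma 5 summed over the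
  star patterns; for `u` = the weakest contact of the GLUED graph it is their Theorem 4; DI-K designates BEFORE gluing.
[cite: KozmaNitzan2024, Thm 4 and Lemma 5 (§3.2, pp. 12–14), eq. (3) p. 3, §3.1 (gluing)]
-/

namespace Summit.CriticalPhenomena.PercolationContinuityZ3.Theorems

open MeasureTheory Set
open Literature.Probability.LatticeModels (prodBernoulli)
open Literature.Probability.Percolation (BondConfig openConn openGraph)

noncomputable section
open Classical

section FingerDomination

open Literature.Probability.LatticeModels Literature.Probability.Percolation

variable {n : ℕ}

/-- **Star form of the finger multi-edge Lemma 3.**  With `R` = some pair `N–A` open, `M = {d ↮ N}`, `U = ⋃_{v∈N}{v↔b}`: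
`μ_K(R ∩ M ∩ {d↔b}) ≤ μ_K(R ∩ M ∩ U)  ⟺  μ_K(R ∩ {d↔b}) + μ_K(U ∩ Mᶜ ∩ {d↔b}ᶜ) ≤ μ_K(U)` (finger block: `b, d ∈ A`,
`Disjoint N A`, every positive-weight pair at `N` goes to `A` or stays inside `N`).
[cite: KozmaNitzan2024, eq. (3) p. 3, Thm 4 (pp. 12–14)] -/
theorem fingerML3_setForm_iff_starForm (K : Sym2 (Fin n) → unitInterval) (A N : Finset (Fin n)) (d b : Fin n)
    (hb : b ∈ A) (hd : d ∈ A) (hNA : Disjoint N A)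
    (hfree : ∀ v ∈ N, ∀ y : Fin n, y ∉ A → y ∉ N → (K s(v, y) : ℝ) = 0) :
    ((prodBernoulli K).real
        ({ω : Set (Sym2 (Fin n)) | ∃ v ∈ N, ∃ a ∈ A, s(v, a) ∈ ω} ∩
          {ω : BondConfig (Fin n) | ∀ x ∈ (↑N : Set (Fin n)), ¬ (openGraph ω).Reachable d x} ∩ openConn d b) ≤
      (prodBernoulli K).real
        ({ω : Set (Sym2 (Fin n)) | ∃ v ∈ N, ∃ a ∈ A, s(v, a) ∈ ω} ∩
          {ω : BondConfig (Fin n) | ∀ x ∈ (↑N : Set (Fin n)), ¬ (openGraph ω).Reachable d x} ∩ ⋃ v ∈ N, openConn v b)) ↔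
    ((prodBernoulli K).real ({ω : Set (Sym2 (Fin n)) | ∃ v ∈ N, ∃ a ∈ A, s(v, a) ∈ ω} ∩ openConn d b) +
      (prodBernoulli K).real ((⋃ v ∈ N, openConn v b) ∩
          {ω : BondConfig (Fin n) | ∀ x ∈ (↑N : Set (Fin n)), ¬ (openGraph ω).Reachable d x}ᶜ ∩ (openConn d b)ᶜ) ≤
      (prodBernoulli K).real (⋃ v ∈ N, openConn v b)) := by
  set M : Set (BondConfig (Fin n)) :=
    {ω : BondConfig (Fin n) | ∀ x ∈ (↑N : Set (Fin n)), ¬ (openGraph ω).Reachable d x} with hM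
  set R : Set (BondConfig (Fin n)) := {ω : Set (Sym2 (Fin n)) | ∃ v ∈ N, ∃ a ∈ A, s(v, a) ∈ ω} with hR
  set U : Set (BondConfig (Fin n)) := ⋃ v ∈ N, (openConn v b : Set (BondConfig (Fin n))) with hU
  set Db : Set (BondConfig (Fin n)) := openConn d b with hDb
  have hmeas : ∀ s : Set (BondConfig (Fin n)), MeasurableSet s := fun _ => MeasurableSet.of_discrete
  -- the null set: off `R` the block reaches no relay
  have hnull := finger_noContact_reach_null K A N hNA hfree
  have hUsub : Rᶜ ∩ U ⊆ Rᶜ ∩ ⋃ v ∈ N, ⋃ a ∈ A, (openConn v a : Set (BondConfig (Fin n))) := by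
    rintro ω ⟨hωR, hωU⟩
    refine ⟨hωR, ?_⟩
    obtain ⟨v, hv, hvb⟩ := Set.mem_iUnion₂.1 hωU
    exact Set.mem_iUnion₂.2 ⟨v, hv, Set.mem_iUnion₂.2 ⟨b, hb, hvb⟩⟩
  have hMsub : Rᶜ ∩ Mᶜ ⊆ Rᶜ ∩ ⋃ v ∈ N, ⋃ a ∈ A, (openConn v a : Set (BondConfig (Fin n))) := by
    rintro ω ⟨hωR, hωM⟩
    refine ⟨hωR, ?_⟩
    have hx : ∃ x ∈ (↑N : Set (Fin n)), (openGraph ω).Reachable d x := by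
      by_contra hcon
      push Not at hcon
      exact hωM hcon
    obtain ⟨x, hxN, hdx⟩ := hx
    exact Set.mem_iUnion₂.2 ⟨x, Finset.mem_coe.1 hxN, Set.mem_iUnion₂.2 ⟨d, hd, (hdx.symm :)⟩⟩
  have hnullU : (prodBernoulli K).real (Rᶜ ∩ U) = 0 :=
    le_antisymm ((measureReal_mono hUsub (measure_ne_top _ _)).trans (le_of_eq hnull)) measureReal_nonneg
  have hnullM : (prodBernoulli K).real (Rᶜ ∩ Mᶜ) = 0 :=
    le_antisymm ((measureReal_mono hMsub (measure_ne_top _ _)).trans (le_of_eq hnull)) measureReal_nonneg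
  -- (1) μ(R ∩ M ∩ U) = μ(U) - μ(U ∩ Mᶜ)
  have hs1 := measureReal_inter_add_sdiff (μ := prodBernoulli K) (s := U) (hmeas M) (measure_ne_top _ _)
  have hs2 := measureReal_inter_add_sdiff (μ := prodBernoulli K) (s := U ∩ M) (hmeas R) (measure_ne_top _ _)
  have e1 : U ∩ M ∩ R = R ∩ M ∩ U := by
    ext ω; simp only [Set.mem_inter_iff]; tauto
  have e1' : (prodBernoulli K).real ((U ∩ M) \ R) = 0 := by
    refine le_antisymm ((measureReal_mono ?_ (measure_ne_top _ _)).trans (le_of_eq hnullU)) measureReal_nonneg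
    rintro ω ⟨⟨hωU, -⟩, hωR⟩
    exact ⟨hωR, hωU⟩
  have e1'' : U \ M = U ∩ Mᶜ := by
    ext ω; simp only [Set.mem_sdiff, Set.mem_inter_iff, Set.mem_compl_iff]
  -- (2) μ(R ∩ M ∩ Db) = μ(R ∩ Db) - μ(Db ∩ Mᶜ)
  have hs3 := measureReal_inter_add_sdiff (μ := prodBernoulli K) (s := R ∩ Db) (hmeas M) (measure_ne_top _ _)
  have hs4 := measureReal_inter_add_sdiff (μ := prodBernoulli K) (s := Db ∩ Mᶜ) (hmeas R) (measure_ne_top _ _)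
  have e2 : R ∩ Db ∩ M = R ∩ M ∩ Db := by
    ext ω; simp only [Set.mem_inter_iff]; tauto
  have e2' : (R ∩ Db) \ M = Db ∩ Mᶜ ∩ R := by
    ext ω; simp only [Set.mem_sdiff, Set.mem_inter_iff, Set.mem_compl_iff]; tauto
  have e2'' : (prodBernoulli K).real ((Db ∩ Mᶜ) \ R) = 0 := by
    refine le_antisymm ((measureReal_mono ?_ (measure_ne_top _ _)).trans (le_of_eq hnullM)) measureReal_nonneg
    rintro ω ⟨⟨-, hωM⟩, hωR⟩
    exact ⟨hωR, hωM⟩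
  -- (3) μ(U ∩ Mᶜ) = μ(Db ∩ Mᶜ) + μ(U ∩ Mᶜ ∩ Dbᶜ)
  have hs5 := measureReal_inter_add_sdiff (μ := prodBernoulli K) (s := U ∩ Mᶜ) (hmeas Db) (measure_ne_top _ _)
  have e3 : U ∩ Mᶜ ∩ Db = Db ∩ Mᶜ := by
    ext ω
    simp only [Set.mem_inter_iff, Set.mem_compl_iff]
    constructor
    · rintro ⟨⟨-, hωM⟩, hωD⟩; exact ⟨hωD, hωM⟩
    · rintro ⟨hωD, hωM⟩
      refine ⟨⟨?_, hωM⟩, hωD⟩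
      have hx : ∃ x ∈ (↑N : Set (Fin n)), (openGraph ω).Reachable d x := by
        by_contra hcon
        push Not at hcon
        exact hωM hcon
      obtain ⟨x, hxN, hdx⟩ := hx
      exact Set.mem_iUnion₂.2 ⟨x, Finset.mem_coe.1 hxN, (hdx.symm.trans (show (openGraph ω).Reachable d b from hωD) :)⟩
  have e3' : (U ∩ Mᶜ) \ Db = U ∩ Mᶜ ∩ Dbᶜ := by
    ext ω; simp only [Set.mem_sdiff, Set.mem_inter_iff, Set.mem_compl_iff]
  rw [e1] at hs2
  rw [e1''] at hs1
  rw [e2, e2'] at hs3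
  rw [e3, e3'] at hs5
  constructor
  · intro h; linarith
  · intro h; linarith

/-- **FML3 from its star form**: if `μ_K(R ∩ {d↔b}) + μ_K(U ∩ {d↔N} ∩ {d↮b}) ≤ μ_K(U)` then the conclusion of `stub_fingerML3_vp`
holds (glued form, via `fingerML3_of_setForm`). [cite: KozmaNitzan2024, eq. (3) p. 3, Thm 4 (pp. 12–14)] -/
theorem fingerML3_of_starForm (K : Sym2 (Fin n) → unitInterval) (A N : Finset (Fin n)) (d b : Fin n)
    (hb : b ∈ A) (hd : d ∈ A) (hNA : Disjoint N A)
    (hfree : ∀ v ∈ N, ∀ y : Fin n, y ∉ A → y ∉ N → (K s(v, y) : ℝ) = 0)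
    (hstar : (prodBernoulli K).real ({ω : Set (Sym2 (Fin n)) | ∃ v ∈ N, ∃ a ∈ A, s(v, a) ∈ ω} ∩ openConn d b) +
      (prodBernoulli K).real ((⋃ v ∈ N, openConn v b) ∩
          {ω : BondConfig (Fin n) | ∀ x ∈ (↑N : Set (Fin n)), ¬ (openGraph ω).Reachable d x}ᶜ ∩ (openConn d b)ᶜ) ≤
      (prodBernoulli K).real (⋃ v ∈ N, openConn v b)) :
    (prodBernoulli (fun e' : Sym2 (Fin n) => if (∀ y ∈ e', y ∈ N) ∧ ¬ e'.IsDiag then 1 else K e')).real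
        ({ω : Set (Sym2 (Fin n)) | ∃ v ∈ N, ∃ a ∈ A, s(v, a) ∈ ω} ∩ openConn d b) ≤
      (prodBernoulli (fun e' : Sym2 (Fin n) => if (∀ y ∈ e', y ∈ N) ∧ ¬ e'.IsDiag then 1 else K e')).real
        ({ω : Set (Sym2 (Fin n)) | ∃ v ∈ N, ∃ a ∈ A, s(v, a) ∈ ω} ∩ ⋃ v ∈ N, openConn v b) :=
  fingerML3_of_setForm K A N d b hNA ((fingerML3_setForm_iff_starForm K A N d b hb hd hNA hfree).2 hstar)

/-- **Reduction of `stub_fingerML3_vp` to the domination inequality DI-K.**  If some vertex `u` satisfies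
(DI-K) `μ_K(R ∩ {u↔b}) + μ_K(U ∩ {d↔N} ∩ {d↮b}) ≤ μ_K(U)` and (Γ) `μ_K(R ∩ {d↔b}) ≤ μ_K(R ∩ {u↔b})`, then the stub's conclusion
holds.  With `u` the contact minimising the unglued `μ_K(·↔b)`, (Γ) is the stub's hypothesis read on `R` and (DI-K) is the depth prover's
conjecture (Kozma–Nitzan's Theorem 4 with the designation computed before gluing). [cite: KozmaNitzan2024, Thm 4, Lemma 5 (pp. 12–14)] -/
theorem fingerML3_of_domination (K : Sym2 (Fin n) → unitInterval) (A N : Finset (Fin n)) (d b u : Fin n)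
    (hb : b ∈ A) (hd : d ∈ A) (hNA : Disjoint N A)
    (hfree : ∀ v ∈ N, ∀ y : Fin n, y ∉ A → y ∉ N → (K s(v, y) : ℝ) = 0)
    (hdik : (prodBernoulli K).real ({ω : Set (Sym2 (Fin n)) | ∃ v ∈ N, ∃ a ∈ A, s(v, a) ∈ ω} ∩ openConn u b) +
      (prodBernoulli K).real ((⋃ v ∈ N, openConn v b) ∩
          {ω : BondConfig (Fin n) | ∀ x ∈ (↑N : Set (Fin n)), ¬ (openGraph ω).Reachable d x}ᶜ ∩ (openConn d b)ᶜ) ≤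
      (prodBernoulli K).real (⋃ v ∈ N, openConn v b))
    (hcmp : (prodBernoulli K).real ({ω : Set (Sym2 (Fin n)) | ∃ v ∈ N, ∃ a ∈ A, s(v, a) ∈ ω} ∩ openConn d b) ≤
      (prodBernoulli K).real ({ω : Set (Sym2 (Fin n)) | ∃ v ∈ N, ∃ a ∈ A, s(v, a) ∈ ω} ∩ openConn u b)) :
    (prodBernoulli (fun e' : Sym2 (Fin n) => if (∀ y ∈ e', y ∈ N) ∧ ¬ e'.IsDiag then 1 else K e')).real
        ({ω : Set (Sym2 (Fin n)) | ∃ v ∈ N, ∃ a ∈ A, s(v, a) ∈ ω} ∩ openConn d b) ≤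
      (prodBernoulli (fun e' : Sym2 (Fin n) => if (∀ y ∈ e', y ∈ N) ∧ ¬ e'.IsDiag then 1 else K e')).real
        ({ω : Set (Sym2 (Fin n)) | ∃ v ∈ N, ∃ a ∈ A, s(v, a) ∈ ω} ∩ ⋃ v ∈ N, openConn v b) :=
  fingerML3_of_starForm K A N d b hb hd hNA hfree (by linarith)

end FingerDomination

end

end Summit.CriticalPhenomena.PercolationContinuityZ3.Theorems
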